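import Summits.AtomisticToContinuum.FouriersLaw.Theorems.ParityLiouvilleSeedLiouvilleForHeatHarmonicDefs

/-!
# The radiating Gaussian state of the harmonic chain: noise drift and finite windows (definitions)

Definitions for the TIME INVARIANCE part of the harmonic tightness witness of
`ParityLiouvilleSeed.LiouvilleForHeat` (`stmt-AtomisticToContinuum-13980`) /
`ZeroCurrentRigidity` (`stmt-AtomisticToContinuum-12073`); objects of
`ParityLiouvilleSeedLiouvilleForHeatHarmonicDefs` (`Idx`, `Src`, `gaussField`, `gaussFieldP`).

The harmonic flow `q̇ = p`, `ṗ_x = -(ω₂+2)q_x + q_{x+1} + q_{x-1}` of `pinnedChain ω₂ 0 0 γ` LIFTS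
through the field map `gaussField` to a linear drift on the noise,

  `ξ̇_x = p_x(ζ)`, `η̇_x = -ω₂ ξ_x - (η_{x+1} - η_{x-1})/2`,
  `ζ̇'_x = -(ξ_x - 2ξ_{x+1} + ξ_{x+2})/2 - (ζ'_{x+1} - ζ'_{x-1})/2`

(`noiseDrift`), which is SKEW for the noise covariance `diag(1, ω₂, 1)`; this is why the radiating
state is stationary. The proofs run on finite windows of the noise:

* `WIdx L = Fin (2L+1) × Fin 3`, `winIdx L : WIdx L → Idx` (site `a ↦ a - L`), `winRestrict`,
  `winExt` (extension by zero);
* `winFieldLin R L` — the linear map `z ↦ box_R (gaussField (winExt z))` from window noise to box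
  phase coordinates; `winDriftLin ω₂ L` — the window truncation `z ↦ (noiseDrift (winExt z)) ∘ winIdx`
  of the drift (a linear map of the window noise space).
-/

noncomputable section

open MeasureTheory ProbabilityTheory
open scoped NNReal
open Literature.MathematicalPhysics.KineticTheory.HeatConduction

namespace Summit.AtomisticToContinuum.FouriersLaw.Theorems.ParityLiouvilleSeed.HarmonicWitness

/-! ### The noise drift -/

/-- **The lift of the harmonic flow to the noise**: the linear vector field `B ζ` on `Src` with
`ξ̇_x = p_x(ζ)`, `η̇_x = -ω₂ ξ_x - (η_{x+1} - η_{x-1})/2`,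
`ζ̇'_x = -(ξ_x - 2ξ_{x+1} + ξ_{x+2})/2 - (ζ'_{x+1} - ζ'_{x-1})/2`. [folklore] -/
def noiseDrift (ω₂ : ℝ) (ζ : Src) : Src := fun k =>
  match k with
  | (x, 0) => gaussFieldP ζ x
  | (x, 1) => -ω₂ * ζ (x, 0) - (ζ (x + 1, 1) - ζ (x - 1, 1)) / 2
  | (x, 2) => -(ζ (x, 0) - 2 * ζ (x + 1, 0) + ζ (x + 2, 0)) / 2 - (ζ (x + 1, 2) - ζ (x - 1, 2)) / 2

/-- [folklore] -/
@[simp] theorem noiseDrift_apply_zero (ω₂ : ℝ) (ζ : Src) (x : ℤ) : noiseDrift ω₂ ζ (x, 0) = gaussFieldP ζ x := rfl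

/-- [folklore] -/
@[simp] theorem noiseDrift_apply_one (ω₂ : ℝ) (ζ : Src) (x : ℤ) :
    noiseDrift ω₂ ζ (x, 1) = -ω₂ * ζ (x, 0) - (ζ (x + 1, 1) - ζ (x - 1, 1)) / 2 := rfl

/-- [folklore] -/
@[simp] theorem noiseDrift_apply_two (ω₂ : ℝ) (ζ : Src) (x : ℤ) :
    noiseDrift ω₂ ζ (x, 2) = -(ζ (x, 0) - 2 * ζ (x + 1, 0) + ζ (x + 2, 0)) / 2 - (ζ (x + 1, 2) - ζ (x - 1, 2)) / 2 :=
  rfl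

/-- `gaussFieldP` is additive in the noise. [folklore] -/
theorem gaussFieldP_add (ζ ζ' : Src) (x : ℤ) : gaussFieldP (ζ + ζ') x = gaussFieldP ζ x + gaussFieldP ζ' x := by
  simp only [gaussFieldP, Pi.add_apply]; ring

/-- `gaussFieldP` is homogeneous in the noise. [folklore] -/
theorem gaussFieldP_smul (c : ℝ) (ζ : Src) (x : ℤ) : gaussFieldP (c • ζ) x = c * gaussFieldP ζ x := by
  simp only [gaussFieldP, Pi.smul_apply, smul_eq_mul]; ring

/-- `gaussField` is additive in the noise. [folklore] -/
theorem gaussField_add (ζ ζ' : Src) : gaussField (ζ + ζ') = gaussField ζ + gaussField ζ' := by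
  funext x
  refine Prod.ext rfl ?_
  simp only [gaussField_apply_snd, Pi.add_apply, Prod.snd_add, gaussFieldP_add]

/-- `gaussField` is homogeneous in the noise. [folklore] -/
theorem gaussField_smul (c : ℝ) (ζ : Src) : gaussField (c • ζ) = c • gaussField ζ := by
  funext x
  refine Prod.ext ?_ ?_
  · simp [gaussField]
  · simp only [gaussField_apply_snd, Pi.smul_apply, Prod.smul_snd, smul_eq_mul, gaussFieldP_smul]

/-- The drift is additive. [folklore] -/
theorem noiseDrift_add (ω₂ : ℝ) (ζ ζ' : Src) : noiseDrift ω₂ (ζ + ζ') = noiseDrift ω₂ ζ + noiseDrift ω₂ ζ' := by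
  funext k
  obtain ⟨x, s⟩ := k
  fin_cases s
  · simp [gaussFieldP_add]
  · simp only [Fin.mk_one, Fin.isValue, noiseDrift_apply_one, Pi.add_apply]; ring
  · simp only [Fin.reduceFinMk, Fin.isValue, noiseDrift_apply_two, Pi.add_apply]; ring

/-- The drift is homogeneous. [folklore] -/
theorem noiseDrift_smul (ω₂ : ℝ) (c : ℝ) (ζ : Src) : noiseDrift ω₂ (c • ζ) = c • noiseDrift ω₂ ζ := by
  funext k
  obtain ⟨x, s⟩ := k
  fin_cases s
  · simp [gaussFieldP_smul]
  · simp only [Fin.mk_one, Fin.isValue, noiseDrift_apply_one, Pi.smul_apply, smul_eq_mul]; ring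
  · simp only [Fin.reduceFinMk, Fin.isValue, noiseDrift_apply_two, Pi.smul_apply, smul_eq_mul]; ring

/-! ### Finite windows of the noise -/

/-- Window noise indices: sites `{0, …, 2L}` (standing for `{-L, …, L}`) and species. [folklore] -/
abbrev WIdx (L : ℕ) : Type := Fin (2 * L + 1) × Fin 3

/-- The embedding of window indices into noise indices, `(a, s) ↦ (a - L, s)`. [folklore] -/
def winIdx (L : ℕ) (a : WIdx L) : Idx := ((a.1 : ℤ) - L, a.2)

/-- Restriction of the noise to the window. [folklore] -/
def winRestrict (L : ℕ) (ζ : Src) : WIdx L → ℝ := fun a => ζ (winIdx L a)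

/-- Extension by zero of window noise to all of `Idx`. [folklore] -/
def winExt (L : ℕ) (z : WIdx L → ℝ) : Src := fun k =>
  if h : -(L : ℤ) ≤ k.1 ∧ k.1 ≤ L then z (⟨(k.1 + L).toNat, by omega⟩, k.2) else 0

/-- [folklore] -/
@[simp] theorem winIdx_fst (L : ℕ) (a : WIdx L) : (winIdx L a).1 = (a.1 : ℤ) - L := rfl

/-- [folklore] -/
@[simp] theorem winIdx_snd (L : ℕ) (a : WIdx L) : (winIdx L a).2 = a.2 := rfl

/-- [folklore] -/
@[simp] theorem winRestrict_apply (L : ℕ) (ζ : Src) (a : WIdx L) : winRestrict L ζ a = ζ (winIdx L a) := rfl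

/-- The window embedding is injective. [folklore] -/
theorem winIdx_injective (L : ℕ) : Function.Injective (winIdx L) := by
  intro a b h
  simp only [winIdx, Prod.mk.injEq] at h
  refine Prod.ext (Fin.ext ?_) h.2
  have := h.1
  omega

/-- Values of the extension inside the window. [folklore] -/
theorem winExt_apply_of_mem (L : ℕ) (z : WIdx L → ℝ) (k : Idx) (hk : -(L : ℤ) ≤ k.1 ∧ k.1 ≤ L) :
    winExt L z k = z (⟨(k.1 + L).toNat, by omega⟩, k.2) := by
  simp only [winExt, dif_pos hk]

/-- Values of the extension outside the window. [folklore] -/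
theorem winExt_apply_of_not_mem (L : ℕ) (z : WIdx L → ℝ) (k : Idx) (hk : ¬(-(L : ℤ) ≤ k.1 ∧ k.1 ≤ L)) :
    winExt L z k = 0 := by
  simp only [winExt, dif_neg hk]

/-- The extension restricted back to the window is the identity. [folklore] -/
@[simp] theorem winExt_winIdx (L : ℕ) (z : WIdx L → ℝ) (a : WIdx L) : winExt L z (winIdx L a) = z a := by
  have ha : -(L : ℤ) ≤ (winIdx L a).1 ∧ (winIdx L a).1 ≤ L := by
    simp only [winIdx_fst]; constructor <;> omega
  rw [winExt_apply_of_mem L z _ ha]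
  congr 1
  refine Prod.ext (Fin.ext ?_) rfl
  simp only [winIdx_fst]
  omega

/-- On the window, extension after restriction gives back the noise. [folklore] -/
theorem winExt_winRestrict_of_mem (L : ℕ) (ζ : Src) (k : Idx) (hk : -(L : ℤ) ≤ k.1 ∧ k.1 ≤ L) :
    winExt L (winRestrict L ζ) k = ζ k := by
  rw [winExt_apply_of_mem L _ k hk, winRestrict_apply]
  congr 1
  refine Prod.ext ?_ rfl
  simp only [winIdx_fst]
  omega

/-- The extension is additive. [folklore] -/
theorem winExt_add (L : ℕ) (z w : WIdx L → ℝ) : winExt L (z + w) = winExt L z + winExt L w := by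
  funext k
  by_cases hk : -(L : ℤ) ≤ k.1 ∧ k.1 ≤ L
  · simp only [Pi.add_apply, winExt_apply_of_mem L _ k hk]
  · simp only [Pi.add_apply, winExt_apply_of_not_mem L _ k hk, add_zero]

/-- The extension is homogeneous. [folklore] -/
theorem winExt_smul (L : ℕ) (c : ℝ) (z : WIdx L → ℝ) : winExt L (c • z) = c • winExt L z := by
  funext k
  by_cases hk : -(L : ℤ) ≤ k.1 ∧ k.1 ≤ L
  · simp only [Pi.smul_apply, winExt_apply_of_mem L _ k hk, smul_eq_mul]
  · simp only [Pi.smul_apply, winExt_apply_of_not_mem L _ k hk, smul_eq_mul, mul_zero]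

/-- The extension of a coordinate vector is the corresponding coordinate vector of `Src`. [folklore] -/
theorem winExt_single (L : ℕ) (b : WIdx L) : winExt L (Pi.single b 1) = Pi.single (winIdx L b) (1 : ℝ) := by
  funext k
  by_cases hk : -(L : ℤ) ≤ k.1 ∧ k.1 ≤ L
  · rw [winExt_apply_of_mem L _ k hk]
    have hk' : k = winIdx L (⟨(k.1 + L).toNat, by omega⟩, k.2) := by
      refine Prod.ext ?_ rfl
      simp only [winIdx_fst]
      omega
    by_cases hb : (⟨(k.1 + L).toNat, by omega⟩, k.2) = b
    · rw [hb, Pi.single_eq_same, hk', hb, Pi.single_eq_same]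
    · rw [Pi.single_eq_of_ne hb, Pi.single_eq_of_ne]
      intro h
      apply hb
      apply winIdx_injective L
      rw [← hk', h]
  · rw [winExt_apply_of_not_mem L _ k hk, Pi.single_eq_of_ne]
    intro h
    apply hk
    rw [h]
    simp only [winIdx_fst]
    constructor <;> omega

/-! ### The field and the drift on a window, as linear maps -/

/-- **The window field map**: window noise `z ↦ box_R (gaussField (winExt z))`, the box phase
coordinates `(q_x, p_x)_{|x| ≤ R}` as a linear function of the window noise. [folklore] -/
def winFieldLin (R L : ℕ) : (WIdx L → ℝ) →ₗ[ℝ] (Fin (2 * R + 1) → ℝ × ℝ) where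
  toFun z := boxRestrict R (gaussField (winExt L z))
  map_add' z w := by
    rw [winExt_add, gaussField_add]; rfl
  map_smul' c z := by
    rw [winExt_smul, gaussField_smul]; rfl

/-- **The window drift**: `z ↦ (noiseDrift (winExt z)) ∘ winIdx`, the truncation of the noise drift
to the window, a linear vector field on the window noise space. [folklore] -/
def winDriftLin (ω₂ : ℝ) (L : ℕ) : (WIdx L → ℝ) →ₗ[ℝ] (WIdx L → ℝ) where
  toFun z a := noiseDrift ω₂ (winExt L z) (winIdx L a)
  map_add' z w := by
    funext a
    rw [winExt_add, noiseDrift_add]; rfl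
  map_smul' c z := by
    funext a
    rw [winExt_smul, noiseDrift_smul]; rfl

/-- [folklore] -/
@[simp] theorem winFieldLin_apply (R L : ℕ) (z : WIdx L → ℝ) :
    winFieldLin R L z = boxRestrict R (gaussField (winExt L z)) := rfl

/-- [folklore] -/
@[simp] theorem winDriftLin_apply (ω₂ : ℝ) (L : ℕ) (z : WIdx L → ℝ) (a : WIdx L) :
    winDriftLin ω₂ L z a = noiseDrift ω₂ (winExt L z) (winIdx L a) := rfl

end Summit.AtomisticToContinuum.FouriersLaw.Theorems.ParityLiouvilleSeed.HarmonicWitness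

end
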